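import Mathlib
import Literature.AlgebraicGeometry.HodgeTheory.FermatShiodaCondition

/-!
# All-unit Hodge QUADRUPLES at the exceptional levels `N = 21, 39` are two pairs — kernel enumeration (`HodgeFermat/QuadEnum.lean`; HF-G27)

Tree copy of the module `HodgeFermat/QuadEnum.lean` of the sibling cell's standalone package
`run/shared/lean/pub/pub-hodgefermat/lean/HodgeFermat/` (135 lines, sha256 `ea32ed006ed70f9d…`), source lines 20–135 (all: the
executable checker `unitsL`/`fourth`/`hodgeQ`/`twoPairsB`/`quadStep`/`quadCheck`, its kernel evaluations `quadCheck_21 = true`,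
`quadCheck_39 = true`, the control `quadCheck_20 = false` (all by `decide +kernel`, no `native_decide`), and the soundness theorems
`twoPairs_of_quadCheck`, `twoPairs_small` — every all-unit Hodge quadruple `{a, b, c, d}` over `ZMod 21` / `ZMod 39` splits into two
pairs) — pub-hodgefermat `CERT.md` l.912, GATE HF-G27; cell record `check/QuadEnum_standalone.lean` (hub `lean check` rc 0).  Used by
`HodgeFermatCorollaryUPrimeFinal.lean` (`quadruple_odd`: every all-unit Hodge quadruple at EVERY odd level is two pairs) and
`HodgeFermatTheoremUShared.lean` (THEOREM U in shared-entry form at 21 and 39).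
Filed by cell `pub-hfermat`, seat prover-1 gen-5, on the COORDINATOR KEEPER RULING of 2026-08-25 (gem sweep H1: take the
off-gate kernel theorem `thmFstar` through the gate; every form of THEOREM F* is on-gate since 2026-08-25/26, gen-0/2/3/4), as
successor work of the same verbatim-port kind: the sibling's off-gate gate records HF-G27 / HF-G27b / HF-G27c — COROLLARY U′
(all-unit Hodge multisets with few distinct residues are sums of pairs), its printed-threshold forms U♯, and THEOREM U in
shared-entry form — on top of the landed LEMMA W / THEOREM U / U⁺ / U⁼ chain (`HodgeFermatTheoremU.lean`,
`HodgeFermatLemmaWFourier.lean`, `HodgeFermatTheoremUPlus.lean`, `HodgeFermatTheoremUEq.lean`, `HodgeFermatPropDPrimeNFinal.lean`).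
Deviations from the source module, exhaustively: the `import` lines (`Mathlib`; the tree's `Literature.AlgebraicGeometry.HodgeTheory.FermatShiodaCondition`
— the source's one import `HodgeFermat.Lattice` serves only to reach the vendored copy of that Literature file, whose predicate
`IsHodgeMultiset`/`mNormSum` is all this module uses of it; `HodgeFermatLattice.lean` is filed alongside); this docstring (replacing the
module docstring, quoted below); one-line docstrings added (gate lint) to the six undocumented declarations `quadCheck_21`,
`quadCheck_39`, `mem_unitsL`, `mem_unitsL_of_isUnit`, `val_mul_nat`, `add_eq_zero_of_mod`.  Every other line — in particular every
declaration's statement and proof — is byte-identical to the source (l.20–135).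
Trust base: no `sorry`, no `native_decide`; `decide +kernel` for the three finite evaluations (as certified in the sibling);
axioms = [propext, Classical.choice, Quot.sound].
HONEST FRAMING: explicit algebraic cycles for specific Hodge classes on Fermat/Delsarte varieties; residual open instances
listed; no claim on general Hodge.  (This file is arithmetic of CM types / finite combinatorics of the sibling's KR-free
programme; it claims nothing about cycles.)

The docstring of `HodgeFermat/QuadEnum.lean` (l.6–18), verbatim:

## All-unit Hodge QUADRUPLES at the two exceptional levels `N = 21, 39` are two pairs — kernel enumeration (HF-G27)

COROLLARY U′ (`CorollaryUPrime.lean`) gives "every all-unit Hodge quadruple is two pairs `{x, −x, y, −y}`" at every odd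
level other than `21` and `39`, where LEMMA S / LEMMA W fail.  `tables/SEMI-THEOREM.md` §2 settles the two exceptional
levels "by direct enumeration"; this LIGHT module (imports `Lattice` only) does that enumeration IN THE KERNEL:
`quadCheck N` runs over all triples `(a, b, c)` of units mod `N` (natural representatives), forms the forced fourth
entry `d ≡ −(a + b + c)`, and whenever `d` is a unit and `(a, b, c, d)` satisfies the Hodge length equations
`2 Σ ⟨t x⟩_N = 4N` at every unit `t`, checks that the quadruple is two pairs; `quadCheck_21`, `quadCheck_39` evaluate it
by `decide +kernel` (no `native_decide`), and `twoPairs_of_quadCheck` is its soundness for Hodge multisets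
`{a, b, c, d}` over `ZMod N` (`IsHodgeMultiset`).  `CorollaryUPrimeFinal.quadruple_odd` combines this with COROLLARY U′:
every all-unit Hodge quadruple at EVERY odd level is two pairs.
-/

set_option autoImplicit false

namespace HodgeFermat.KRFree.QuadEnum

open Literature.AlgebraicGeometry.HodgeTheory.FermatCharacter

/-! ## The checker -/

/-- the units of `ℤ/N`, as natural representatives `< N` -/
def unitsL (N : ℕ) : List ℕ := (List.range N).filter fun x => Nat.gcd x N == 1

/-- the forced fourth entry: `d ≡ −(a + b + c) (mod N)`, `d < N` (for `N > 0`) -/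
def fourth (N a b c : ℕ) : ℕ := (N - (a + b + c) % N) % N

/-- the Hodge length equations of the quadruple `(a, b, c, d)`: `2 (⟨ta⟩ + ⟨tb⟩ + ⟨tc⟩ + ⟨td⟩) = 4N` at every unit `t` -/
def hodgeQ (N a b c d : ℕ) : Bool :=
  (unitsL N).all fun t => 2 * (t * a % N + t * b % N + t * c % N + t * d % N) == N * 4

/-- "two pairs": in one of the three pairings both pairs sum to `0 (mod N)` -/
def twoPairsB (N a b c d : ℕ) : Bool :=
  ((a + b) % N == 0 && (c + d) % N == 0) || ((a + c) % N == 0 && (b + d) % N == 0) ||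
    ((a + d) % N == 0 && (b + c) % N == 0)

/-- one triple of units: if the forced fourth entry is a unit and the quadruple is Hodge, it must be two pairs -/
def quadStep (N a b c : ℕ) : Bool :=
  !(Nat.gcd (fourth N a b c) N == 1) || !(hodgeQ N a b c (fourth N a b c)) || twoPairsB N a b c (fourth N a b c)

/-- the finite check at level `N` -/
def quadCheck (N : ℕ) : Bool :=
  (unitsL N).all fun a => (unitsL N).all fun b => (unitsL N).all fun c => quadStep N a b c

/-! ## Kernel evaluations at the two exceptional levels of LEMMA S -/

/-- the kernel evaluation at `N = 21`: every all-unit Hodge quadruple mod `21` is two pairs -/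
theorem quadCheck_21 : quadCheck 21 = true := by decide +kernel

/-- the kernel evaluation at `N = 39`: every all-unit Hodge quadruple mod `39` is two pairs -/
theorem quadCheck_39 : quadCheck 39 = true := by decide +kernel

/-- control instance: the check is not vacuous — it FAILS at the EVEN level `N = 20`, where `{1, 9, 13, 17}` is an
all-unit Hodge quadruple (`⟨t⟩ + ⟨9t⟩ + ⟨13t⟩ + ⟨17t⟩ = 40` for every unit `t`) which is not two pairs; `20` is the
smallest such level (the next are `24`: `{1, 11, 17, 19}` and `30`: `{1, 17, 19, 23}`); by COROLLARY U′ and the two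
evaluations above there is NO such odd level. -/
theorem quadCheck_20 : quadCheck 20 = false := by decide +kernel

/-! ## Soundness -/

/-- membership in `unitsL N`: `x < N` and `x` coprime to `N` -/
lemma mem_unitsL {N x : ℕ} : x ∈ unitsL N ↔ x < N ∧ Nat.Coprime x N := by
  simp [unitsL, List.mem_filter, List.mem_range, Nat.Coprime]

/-- the natural representative of a unit of `ZMod N` lies in `unitsL N` -/
lemma mem_unitsL_of_isUnit {N : ℕ} [NeZero N] {x : ZMod N} (hx : IsUnit x) : x.val ∈ unitsL N :=
  mem_unitsL.mpr ⟨ZMod.val_lt x, (ZMod.isUnit_iff_coprime x.val N).mp (by rwa [ZMod.natCast_zmod_val])⟩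

/-- `val (t • x) = t · val x mod N` for `t < N` -/
lemma val_mul_nat {N : ℕ} [NeZero N] (t : ℕ) (ht : t < N) (x : ZMod N) : ((t : ZMod N) * x).val = t * x.val % N := by
  rw [ZMod.val_mul, ZMod.val_natCast, Nat.mod_eq_of_lt ht]

/-- `x + y = 0` in `ZMod N` from `(val x + val y) % N = 0` -/
lemma add_eq_zero_of_mod {N : ℕ} [NeZero N] {x y : ZMod N} (h : (x.val + y.val) % N = 0) : x + y = 0 := by
  rw [← ZMod.val_eq_zero, ZMod.val_add, h]

/-- **Soundness of the checker.**  If `quadCheck N` passes, every quadruple of units `a, b, c, d` of `ℤ/N` with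
`a + b + c + d = 0` satisfying the Hodge length equations is two pairs. -/
theorem twoPairs_of_quadCheck {N : ℕ} [NeZero N] (hq : quadCheck N = true) {a b c d : ZMod N}
    (ha : IsUnit a) (hb : IsUnit b) (hc : IsUnit c) (hd : IsUnit d) (hsum : a + b + c + d = 0)
    (hH : ∀ t : (ZMod N)ˣ, 2 * mNormSum (({a, b, c, d} : Multiset (ZMod N)).map fun x => (t : ZMod N) * x) = N * 4) :
    (a + b = 0 ∧ c + d = 0) ∨ (a + c = 0 ∧ b + d = 0) ∨ (a + d = 0 ∧ b + c = 0) := by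
  -- the forced fourth entry is `d`
  have hdv : d.val = fourth N a.val b.val c.val := by
    have e : d = -(a + b + c) := by linear_combination hsum
    rw [e, ZMod.neg_val', ZMod.val_add, ZMod.val_add, Nat.mod_add_mod]
    rfl
  -- the step of the checker at `(a, b, c)`
  have step : quadStep N a.val b.val c.val = true :=
    List.all_eq_true.mp (List.all_eq_true.mp (List.all_eq_true.mp hq _ (mem_unitsL_of_isUnit ha)) _
      (mem_unitsL_of_isUnit hb)) _ (mem_unitsL_of_isUnit hc)
  rw [quadStep, ← hdv] at step
  -- `d` is a unit
  have hdu : (Nat.gcd d.val N == 1) = true :=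
    beq_iff_eq.mpr ((ZMod.isUnit_iff_coprime d.val N).mp (by rwa [ZMod.natCast_zmod_val]))
  -- the quadruple passes `hodgeQ`
  have hHQ : hodgeQ N a.val b.val c.val d.val = true := by
    refine List.all_eq_true.mpr fun t ht => beq_iff_eq.mpr ?_
    obtain ⟨htN, htc⟩ := mem_unitsL.mp ht
    have h := hH (ZMod.unitOfCoprime t htc)
    rw [ZMod.coe_unitOfCoprime] at h
    rw [add_assoc, add_assoc]
    simpa [mNormSum, Multiset.insert_eq_cons, val_mul_nat t htN] using h
  rw [hdu, hHQ] at step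
  -- so it is two pairs
  have h2 : twoPairsB N a.val b.val c.val d.val = true := by simpa using step
  simp only [twoPairsB, Bool.or_eq_true, Bool.and_eq_true, beq_iff_eq] at h2
  rcases h2 with (⟨h₁, h₂⟩ | ⟨h₁, h₂⟩) | ⟨h₁, h₂⟩
  · exact Or.inl ⟨add_eq_zero_of_mod h₁, add_eq_zero_of_mod h₂⟩
  · exact Or.inr (Or.inl ⟨add_eq_zero_of_mod h₁, add_eq_zero_of_mod h₂⟩)
  · exact Or.inr (Or.inr ⟨add_eq_zero_of_mod h₁, add_eq_zero_of_mod h₂⟩)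

/-- **All-unit Hodge quadruples at `N = 21` and `N = 39` are two pairs** (as a statement about Hodge multisets
`{a, b, c, d}` over `ZMod N`). -/
theorem twoPairs_small {N : ℕ} (hN : N = 21 ∨ N = 39) {a b c d : ZMod N}
    (hs : IsHodgeMultiset ({a, b, c, d} : Multiset (ZMod N)))
    (ha : IsUnit a) (hb : IsUnit b) (hc : IsUnit c) (hd : IsUnit d) :
    (a + b = 0 ∧ c + d = 0) ∨ (a + c = 0 ∧ b + d = 0) ∨ (a + d = 0 ∧ b + c = 0) := by
  haveI : NeZero N := ⟨by rcases hN with rfl | rfl <;> decide⟩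
  have hq : quadCheck N = true := by
    rcases hN with rfl | rfl
    · exact quadCheck_21
    · exact quadCheck_39
  have hsum : a + b + c + d = 0 := by
    have h := hs.1.2
    simp only [Multiset.insert_eq_cons, Multiset.sum_cons, Multiset.sum_singleton] at h
    linear_combination h
  have hH : ∀ t : (ZMod N)ˣ,
      2 * mNormSum (({a, b, c, d} : Multiset (ZMod N)).map fun x => (t : ZMod N) * x) = N * 4 := by
    intro t
    have h := hs.2 t
    simpa using h
  exact twoPairs_of_quadCheck hq ha hb hc hd hsum hH

end HodgeFermat.KRFree.QuadEnum
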